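/-
Copyright (c) 2026 the pub-hodgecm-mathlib formalisation cell (harness21).  Track B «K2-LIT» prover seat hodgecm-mathlib-K2E3-p21 (g0); second follow-on helper of row #21
(`sig_K2E3EPFunctionGWild`, ★ p854998): Kottwitz's `f_EP` on `U(Φ₃)(L⁺_v)` at ANY ramified non-split place WITH ITS SHAPE DISPLAYED (the wild ∕ characteristic-free twin of
★ (G3)-EXPLICIT-RAM `F0P3cStCharTSEPGlueGExplicitRamified`).  2026-09-03.
-/
import Summits.HodgeConjecture.HodgeConjecture.Theorems.K2E3EPFunctionGWild   -- ★ p854998 (this seat): brings ★ (G3)-RAM FILE A (§0 (T1), §1 sign), ★ WILD datum ∕ transitivity ∕ Euler ∕ indices (Track A U0), ★ THEOREM C₃ `…_of_transitive`, the ★ (G3) kit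
import HarnessLib

/-!
# K2 · E3 · U5-a follow-on — file `K2E3EPFunctionGRamifiedExplicit`: KOTTWITZ'S `f_EP` ON `G_v = U(Φ₃)(L⁺_v)` AT ANY RAMIFIED NON-SPLIT PLACE (tame OR wild), WITH ITS SHAPE
# DISPLAYED `f_G = νQv(K₀)⁻¹·𝟙_{K₀} + νQv(K₁)⁻¹·𝟙_{K₁} − νQv(I)⁻¹·𝟙_I` [Kottwitz1988 §2 Thm. 2; Rogawski1990 §12.6; Tits1979 §2.7 (ramified quasi-split `²A₂`, local index `(q+1, q+1)`)]

Cell `pub/hodgecm-mathlib` (D-0151), Track B «K2-LIT», crux H413 = `stmt-HodgeConjecture-24833` (lane `--kind proof --supports … --as helper`), route of record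
`HCCMUnconditional`; seat K2E3-p21 (g0).  THEOREMS ONLY (no definition ∕ instance ∕ notation ∕ named fact ∕ `sorry`); ★-only imports (never a `Cruxes/…/Lines` module);
count-neutral (closes no node, implies no rider).

WHAT.  ★ p854998 `K2E3EPFunctionGWild.epFunctionGWild` (socket #21) and ★ (G3)-RAM `exists_epFunction_G_of_ramified` hide Kottwitz's function behind `∃ fG`; the EP-road
consumers at a ramified place — the pseudo-coefficient WITNESS (★ 58-WITNESS-RAM `isPseudoCoeff_epFunction_of_neg_explicit`), the induced-trace-zero letter (★ 61b-RAM), a 2b-style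
TRACE TABLE `Tr σ(f_G) = dim σ^{K₀} + dim σ^{K₁} − dim σ^{I}` (★ INDIC-COMB `IrrClass.smoothTrace_mk_epShape`) — need the SHAPE, the levels `K₀ K₁ I` as letters and `g₁ = diag(1,1,ϖ)`
at THEIR OWN uniformiser.  This file states the SAME eight clauses as ★ (G3)-EXPLICIT-RAM `epFunction_G_explicit_of_ramified` (p853167), token for token, for the DISPLAYED
function, with the TAME BLOCK binders `(hσϖ : σ_w ϖ = −ϖ) (hres) (h2w : |2|_w = 1) (hnorm)` REPLACED BY THE SINGLE PLACE LETTER `(he : e(w|v) ≠ 1)` — `ϖ` is ANY uniformiser of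
`L_w` (`hϖ : |ϖ|_w = exp(−1)`), there is NO hypothesis on `|2|_w`: the statement covers the tame AND the wild (dyadic) ramified places at once — and the same
`(g₁) (hg₁) (eA) (heA) (K0 K1 I) (hK0) (hK1) (hI) … (fG) (hfG)` letters (`rfl` ×4 at the consumer).  The level facts a consumer needs next to it (`K₀, K₁, I` compact open of non-zero
volume) are ★ (G3)-EXPLICIT ED. 2's `isOpen_isCompact_epLevels` ∕ `measureReal_epLevels_ne_zero` AS THEY STAND (they take no datum).

HOW.  The proof of ★ p854998 with `fG`, `eA`, `K₀ K₁ I` as binders instead of constructed (the ★ (G3)-RAM FILE B → ★ (G3)-EXPLICIT-RAM diff applied to the wild file): the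
RAMIFIED QUADRATIC DATUM `IsRamifiedQuadraticDatum σ_w ϖ d t` of ★ `exists_isRamifiedQuadraticDatum_of_placesOver` at the consumer's OWN uniformiser `ϖ` (no parity ∕ tameness
condition); value at one: ★ `index_inf_subgroupOf_eq_of_isRamifiedQuadraticDatum` (Track A U0 `stub_U0_iwahoriIndex_wild`, p854731) + ★ `measureReal_coe_eq_index_mul` + ★ §1
`epValueAtOne_neg_of_ramified`; (E) ★ EULER-G-WILD `fixedSet_subtree_of_isRamifiedQuadraticDatum` (U0 `stub_U0_fixedSet_subtree`, p854681); (N) ★ THEOREM C₃ FOR ANY INVOLUTION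
`epCombination_classOrbitalIntegral_eq_zero_of_latticeModel_three_of_transitive` with (A) ★ htr₀-WILD p854568, (B) ★ `htr₂_of_isRamifiedQuadraticDatum` p854580, (I) ★
`flagTransitive_of_isRamifiedQuadraticDatum` p854659, kit (T1) := ★ (G3)-RAM §0 `…_of_v` (any uniformiser), (T2) := ★ `exists_splitTorus_generator_local_of_nonsplit_three_of_involution`
(`e τ = diag(ϖ⁻¹, 1, σ_w ϖ)`); ★ GLUE `classOrbitalIntegral_epCombination_eq(_of_compactSpace)`, ★ `isLocSmooth_epCombination`, the compact-open levels UNCHANGED.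

* §1 **`epFunction_G_explicit_of_ramificationIdx_ne_one`** — `IsLocSmooth fG ∧ Measurable fG ∧ Integrable fG νQv ∧ ∫ fG ∂νQv = 1 ∧ (fG 1).im = 0 ∧ (fG 1).re < 0 ∧
  (Φ = 1 on elliptic regular classes) ∧ (Φ = 0 on non-elliptic regular classes)` for the displayed `fG` at a ramified `w ∣ v` and ANY uniformiser `ϖ` of `L_w`.
HONEST LABEL: count-neutral input helper (`--supports 24833 --as helper`): it displays the EP-G column's function at EVERY ramified place (tame re-proved, WILD new) for the
EP-road letters at wild places (K1 witness, 61b, 2b′ trace tables); h413 OPEN; HC_CM is proved only modulo the 7 printed citations (2 remaining named inputs: hLiu418 =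
`stmt-HodgeConjecture-24832`, h413 = `stmt-HodgeConjecture-24833`) until rung 0 closes.

## References
* [Kottwitz1988] R. E. Kottwitz, *Tamagawa numbers*, Ann. of Math. 127 (1988), §2 Theorem 2 (Euler–Poincaré functions; no tameness hypothesis; rank one: `Φ(γ, f_EP) = χ(𝒯^γ)`).
* [Rogawski1990] J. D. Rogawski, *Automorphic Representations of Unitary Groups in Three Variables* (1990), §12.6 p. 187 (pseudo-coefficients), §12.3 p. 176, §3.6 pp. 28–31.
* [Tits1979] J. Tits, *Reductive groups over local fields*, PSPM 33.1 (1979), §2.7 (p. 48), §2.10 (p. 49) (rank-one groups; the ramified `²A₂`: local index `(q+1, q+1)`).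
* [BruhatTits1972] F. Bruhat, J. Tits, *Groupes réductifs sur un corps local I*, Publ. Math. IHÉS 41 (1972), §10 (lattice models; vertex stabilisers).
* [Serre1980Trees] J.-P. Serre, *Trees* (1980), I.6.1, I.6.4, II.1.1–1.3.
-/

set_option autoImplicit false
-- the mandated namespace has the single-problem summit's repeated segment (`HodgeConjecture.HodgeConjecture`)
set_option linter.dupNamespace false

noncomputable section

open NumberField IsDedekindDomain MeasureTheory Topology
open scoped Matrix MatrixGroups Valued
open Literature.NumberTheory.Rogawski1990 Literature.NumberTheory.Automorphic Literature.NumberTheory.Automorphic.UnitaryGroup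
open Literature.NumberTheory.Automorphic.UnitaryThreeFourFrame
open Literature.NumberTheory.GaloisRepresentations
open Summit.HodgeConjecture.HodgeConjecture.Cruxes.H413.F0P3cStCharTSTorusDefs
open Summit.HodgeConjecture.HodgeConjecture.Cruxes.H413.F0P3cStCharTSEPGlueG
open Summit.HodgeConjecture.HodgeConjecture.Cruxes.H413.F0P3cStCharTSEPGlueGRamified
open Summit.HodgeConjecture.HodgeConjecture.Cruxes.H413.F0P3cDyRamWildPlaceDatum
open Summit.HodgeConjecture.HodgeConjecture.Cruxes.H413.F0P3cDyRamWildTransitivity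

namespace Summit.HodgeConjecture.HodgeConjecture.Cruxes.H413.K2E3EPFunctionGRamifiedExplicit

variable (L : Type) [Field L] [NumberField L] [IsCMField L] (v : HeightOneSpectrum (𝓞 ↥(maximalRealSubfield L)))

/-! ## §1 Kottwitz's `f_EP` on `U(Φ₃)(L⁺_v)` at any ramified non-split place, shape displayed -/

set_option maxHeartbeats 1600000 in  -- statement-level `whnf` on the CM carriers + eight clauses, the budget line of ★ (G3)-EXPLICIT-RAM `epFunction_G_explicit_of_ramified` and of ★ p854998 (measured there)
set_option synthInstance.maxHeartbeats 400000 in  -- idem (the socket's own budget line)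
/-- **(G3)-EXPLICIT AT ANY RAMIFIED PLACE: KOTTWITZ'S EULER–POINCARÉ FUNCTION ON `G_v = U(Φ₃)(L⁺_v)`, WITH ITS SHAPE DISPLAYED** (`v` non-split; the place `w ∣ v` RAMIFIED,
`e(w|v) ≠ 1`, of ANY residue characteristic — tame or dyadic; `ϖ` ANY uniformiser of `L_w`).  For ANY topological one-place model `eA : G_v ≃ₜ* U(σ_w, J₀)(L_w)` reading the
matrices of ★ `localNonsplitEquiv` (`heA`), the edge matrix `g₁ = diag(1, 1, ϖ)`, the levels `K₀ = eA⁻¹(GL₃(𝒪_w) ∩ U)`, `K₁ = eA⁻¹(g₁ GL₃(𝒪_w) g₁⁻¹ ∩ U)`, `I = K₀ ⊓ K₁` (the two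
special vertex stabilisers and the Iwahori of the `(q+1)`-regular `U(3)` tree at `w`) and `fG = νQv(K₀)⁻¹𝟙_{K₀} + νQv(K₁)⁻¹𝟙_{K₁} − νQv(I)⁻¹𝟙_I` (binders `hK0 hK1 hI hfG`, all `rfl`
at the consumer): `fG ∈ C_c^∞`, measurable, integrable, `∫ fG dνQv = 1`, `fG 1` real and NEGATIVE (`= νQv(I)⁻¹(2∕(q+1) − 1)`, `q = |𝓀_w| ≥ 2`), and for every family `mQv`
canonical for (`IsRegularElt`, `νQv`) the class orbital integral of `fG` is `1` at every regular class with COMPACT centraliser and `0` at every regular class with NON-compact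
centraliser — the eight clauses of ★ `epFunction_G_explicit_of_ramified`, token for token, its tame block `(hσϖ) (hres) (h2w) (hnorm)` replaced by `(he : e(w|v) ≠ 1)`; inputs ★
BY NAME: the datum ★ `exists_isRamifiedQuadraticDatum_of_placesOver`, ★ `index_inf_subgroupOf_eq_of_isRamifiedQuadraticDatum`, ★ EULER-G-WILD `fixedSet_subtree_of_isRamifiedQuadraticDatum`,
★ THEOREM C₃ `…_of_latticeModel_three_of_transitive` over ★ htr₀-WILD ∕ htr₂-WILD ∕ wild flags, (T1) := ★ (G3)-RAM §0, (T2) := ★ `exists_splitTorus_generator_local_of_nonsplit_three_of_involution`,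
★ GLUE `classOrbitalIntegral_epCombination_eq(_of_compactSpace)`.
[cite: Kottwitz1988, §2 Theorem 2] [cite: Rogawski1990, §12.6 p. 187] [cite: Tits1979, §2.7 (p. 48)] [cite: BruhatTits1972, §10] [cite: Serre1980Trees, II.1.1] -/
theorem epFunction_G_explicit_of_ramificationIdx_ne_one (hns : ∀ w : PlacesOver L v, IsCMField.complexConj L • w.1 = w.1)
    (w : PlacesOver L v) (hw : IsCMField.complexConj L • w.1 = w.1) (he : v.asIdeal.ramificationIdx' w.1.asIdeal ≠ 1)
    {ϖ : w.1.adicCompletion L} (hϖ : Valued.v ϖ = WithZero.exp (-1 : ℤ))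
    (g₁ : GL (Fin 3) (w.1.adicCompletion L)) (hg₁ : (g₁ : Matrix (Fin 3) (Fin 3) (w.1.adicCompletion L)) = Matrix.diagonal ![(1 : w.1.adicCompletion L), 1, ϖ])
    (eA : Gqs L v ≃ₜ* ↥(unitaryGroupOfForm (galAdicCompletionMap (L := L) (IsCMField.complexConj L) hw) ((StdForm.antidiagonal 3).over (w.1.adicCompletion L))))
    (heA : ∀ g : Gqs L v,
      ((eA g : ↥(unitaryGroupOfForm (galAdicCompletionMap (L := L) (IsCMField.complexConj L) hw) ((StdForm.antidiagonal 3).over (w.1.adicCompletion L)))) :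
          GL (Fin 3) (w.1.adicCompletion L)) =
        ((localNonsplitEquiv (IsCMField.complexConj L) (qsForm L) (IsCMField.complexConj_ne_one L) w hw g :
          ↥(unitaryGroupOfForm (galAdicCompletionMap (L := L) (IsCMField.complexConj L) hw) (placeForm (qsForm L) w.1))) : GL (Fin 3) (w.1.adicCompletion L)))
    (K0 K1 I : Subgroup (Gqs L v))
    (hK0 : K0 = ((glInt 3 (w.1.adicCompletion L)).subgroupOf
      (unitaryGroupOfForm (galAdicCompletionMap (L := L) (IsCMField.complexConj L) hw) ((StdForm.antidiagonal 3).over (w.1.adicCompletion L)))).comap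
        eA.toMulEquiv.toMonoidHom)
    (hK1 : K1 = (((glInt 3 (w.1.adicCompletion L)).map (MulAut.conj g₁).toMonoidHom).subgroupOf
      (unitaryGroupOfForm (galAdicCompletionMap (L := L) (IsCMField.complexConj L) hw) ((StdForm.antidiagonal 3).over (w.1.adicCompletion L)))).comap
        eA.toMulEquiv.toMonoidHom)
    (hI : I = K0 ⊓ K1)
    [MeasurableSpace (Gqs L v)] [BorelSpace (Gqs L v)]
    [∀ γ : Gqs L v, MeasurableSpace (Gqs L v ⧸ Subgroup.centralizer ({γ} : Set (Gqs L v)))]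
    [∀ γ : Gqs L v, BorelSpace (Gqs L v ⧸ Subgroup.centralizer ({γ} : Set (Gqs L v)))]
    (νQv : Measure (Gqs L v)) [νQv.IsHaarMeasure] [νQv.IsMulRightInvariant]
    {mQv : OrbitalMeasureFamily (Gqs L v)}
    (hcanQ : mQv.IsCanonical (fun γ => IsRegularElt (γ.val : GL (Fin 3) (UnitaryGroup.LocalRing L v))) νQv)
    (fG : Gqs L v → ℂ)
    (hfG : fG = fun g => (((νQv K0).toReal : ℂ))⁻¹ * (K0 : Set (Gqs L v)).indicator (fun _ => (1 : ℂ)) g +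
      (((νQv K1).toReal : ℂ))⁻¹ * (K1 : Set (Gqs L v)).indicator (fun _ => (1 : ℂ)) g -
      (((νQv I).toReal : ℂ))⁻¹ * (I : Set (Gqs L v)).indicator (fun _ => (1 : ℂ)) g) :
    IsLocSmooth fG ∧ Measurable fG ∧ Integrable fG νQv ∧ ∫ g, fG g ∂νQv = 1 ∧ (fG 1).im = 0 ∧ (fG 1).re < 0 ∧
      (∀ γ : Gqs L v, IsRegularElt (γ.val : GL (Fin 3) (UnitaryGroup.LocalRing L v)) →
        IsCompact ((Subgroup.centralizer ({γ} : Set (Gqs L v))) : Set (Gqs L v)) → classOrbitalIntegral mQv fG (ConjClasses.mk γ) = 1) ∧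
      (∀ γ : Gqs L v, IsRegularElt (γ.val : GL (Fin 3) (UnitaryGroup.LocalRing L v)) →
        ¬ IsCompact ((Subgroup.centralizer ({γ} : Set (Gqs L v))) : Set (Gqs L v)) → classOrbitalIntegral mQv fG (ConjClasses.mk γ) = 0) := by
  classical
  subst hfG
  subst hK0 hK1
  have hc1 : IsCMField.complexConj L ≠ 1 := IsCMField.complexConj_ne_one L
  haveI : Algebra.IsQuadraticExtension ↥(maximalRealSubfield L) L := IsCMField.isQuadraticExtension L
  have hHf : ((qsForm L).map (cmConjRingHom L))ᵀ = qsForm L := UnitaryGroup.antidiagOne_isHermitian L 3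
  have hdetf : (qsForm L).det ≠ 0 := (UnitaryGroup.isUnit_antidiagOne_det L 3).ne_zero
  letI : Fintype 𝓀[w.1.adicCompletion L] := Fintype.ofFinite _
  have hϖv : Valued.v ϖ = WithZero.exp (-1 : ℤ) := hϖ
  -- the ramified quadratic datum carried by the consumer's uniformiser `ϖ` (no parity ∕ tameness condition)
  obtain ⟨d, t, hD⟩ := exists_isRamifiedQuadraticDatum_of_placesOver L w hw he ϖ hϖv
  have hσσ : ∀ x : w.1.adicCompletion L,
      galAdicCompletionMap (L := L) (IsCMField.complexConj L) hw (galAdicCompletionMap (L := L) (IsCMField.complexConj L) hw x) = x :=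
    galAdicCompletionMap_galAdicCompletionMap_of_smul_eq (IsCMField.complexConj L) w hc1 hw
  have hvσ : ∀ x : w.1.adicCompletion L, Valued.v (galAdicCompletionMap (L := L) (IsCMField.complexConj L) hw x) = Valued.v x := fun x =>
    valued_galAdicCompletionMap (L := L) (IsCMField.complexConj L) hw x
  set eU := localNonsplitEquiv (IsCMField.complexConj L) (qsForm L) hc1 w hw with heUdef
  -- the one-place model on the literal form `Φ₃ = antidiag(1,1,1)` (the `StdForm` currency of the lattice-tree files)
  have hJw : placeForm (qsForm L) w.1 = (StdForm.antidiagonal 3).over (w.1.adicCompletion L) := by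
    rw [placeForm, qsForm, antidiagOne_eq_over, StdForm.over_map]
  haveI hTG : IsTopologicalGroup ↥(unitaryGroupOfForm (galAdicCompletionMap (L := L) (IsCMField.complexConj L) hw) ((StdForm.antidiagonal 3).over (w.1.adicCompletion L))) := inferInstance
  set K0w : Subgroup ↥(unitaryGroupOfForm (galAdicCompletionMap (L := L) (IsCMField.complexConj L) hw) ((StdForm.antidiagonal 3).over (w.1.adicCompletion L))) :=
    (glInt 3 (w.1.adicCompletion L)).subgroupOf (unitaryGroupOfForm (galAdicCompletionMap (L := L) (IsCMField.complexConj L) hw) ((StdForm.antidiagonal 3).over (w.1.adicCompletion L))) with hK0wdef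
  set K1w : Subgroup ↥(unitaryGroupOfForm (galAdicCompletionMap (L := L) (IsCMField.complexConj L) hw) ((StdForm.antidiagonal 3).over (w.1.adicCompletion L))) :=
    ((glInt 3 (w.1.adicCompletion L)).map (MulAut.conj g₁).toMonoidHom).subgroupOf (unitaryGroupOfForm (galAdicCompletionMap (L := L) (IsCMField.complexConj L) hw) ((StdForm.antidiagonal 3).over (w.1.adicCompletion L))) with hK1wdef
  have hI' : I = (K0w ⊓ K1w).comap eA.toMulEquiv.toMonoidHom := by rw [hI, ← Subgroup.comap_inf]
  subst hI'
  set K0 : Subgroup (Gqs L v) := K0w.comap eA.toMulEquiv.toMonoidHom with hK0def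
  set K1 : Subgroup (Gqs L v) := K1w.comap eA.toMulEquiv.toMonoidHom with hK1def
  set I : Subgroup (Gqs L v) := (K0w ⊓ K1w).comap eA.toMulEquiv.toMonoidHom with hIdef
  -- compact-open (★ (G0) §2 on `U(σ_w, J₀)(L_w)`, pulled back along the homeomorphism `eA`)
  have hσc : Continuous (galAdicCompletionMap (L := L) (IsCMField.complexConj L) hw) := continuous_galAdicCompletionMap L (IsCMField.complexConj L) hw
  haveI := compactSpace_integer_adicCompletion L w.1
  have hpre : ∀ C : Subgroup ↥(unitaryGroupOfForm (galAdicCompletionMap (L := L) (IsCMField.complexConj L) hw) ((StdForm.antidiagonal 3).over (w.1.adicCompletion L))), ((C.comap eA.toMulEquiv.toMonoidHom : Subgroup (Gqs L v)) : Set (Gqs L v)) = eA ⁻¹' (C : Set ↥(unitaryGroupOfForm (galAdicCompletionMap (L := L) (IsCMField.complexConj L) hw) ((StdForm.antidiagonal 3).over (w.1.adicCompletion L)))) := fun _ => rfl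
  have hK0o : IsOpen (K0 : Set (Gqs L v)) := by
    rw [hK0def, hpre]; exact (UnitaryLatticeTree.isOpen_glInt_subgroupOf (galAdicCompletionMap (L := L) (IsCMField.complexConj L) hw) _).preimage eA.continuous
  have hK0c : IsCompact (K0 : Set (Gqs L v)) := by
    rw [hK0def, hpre]; exact eA.toHomeomorph.isCompact_preimage.2 (UnitaryLatticeTree.isCompact_glInt_subgroupOf (galAdicCompletionMap (L := L) (IsCMField.complexConj L) hw) _ hσc)
  have hK1o : IsOpen (K1 : Set (Gqs L v)) := by
    rw [hK1def, hpre]; exact (UnitaryLatticeTree.isOpen_conj_glInt_subgroupOf (galAdicCompletionMap (L := L) (IsCMField.complexConj L) hw) _ g₁).preimage eA.continuous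
  have hK1c : IsCompact (K1 : Set (Gqs L v)) := by
    rw [hK1def, hpre]; exact eA.toHomeomorph.isCompact_preimage.2 (UnitaryLatticeTree.isCompact_conj_glInt_subgroupOf (galAdicCompletionMap (L := L) (IsCMField.complexConj L) hw) _ g₁ hσc)
  have hIo : IsOpen (I : Set (Gqs L v)) := by
    rw [hIdef, hpre]; exact (UnitaryLatticeTree.isOpen_glInt_inf_conj_glInt_subgroupOf (galAdicCompletionMap (L := L) (IsCMField.complexConj L) hw) _ g₁).preimage eA.continuous
  have hIc : IsCompact (I : Set (Gqs L v)) := by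
    rw [hIdef, hpre]; exact eA.toHomeomorph.isCompact_preimage.2 (UnitaryLatticeTree.isCompact_glInt_inf_conj_glInt_subgroupOf (galAdicCompletionMap (L := L) (IsCMField.complexConj L) hw) _ g₁ hσc)
  -- volumes of compact open subgroups are finite and positive
  have hvol : ∀ S : Subgroup (Gqs L v), IsOpen (S : Set (Gqs L v)) → IsCompact (S : Set (Gqs L v)) → (((νQv S).toReal : ℂ)) ≠ 0 := by
    intro S hSo hSc
    have hpos : 0 < νQv S := hSo.measure_pos νQv ⟨1, S.one_mem⟩
    exact_mod_cast (ENNReal.toReal_pos hpos.ne' hSc.measure_lt_top.ne).ne'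
  have hint : ∀ S : Subgroup (Gqs L v), IsOpen (S : Set (Gqs L v)) → IsCompact (S : Set (Gqs L v)) → ∀ c : ℂ,
      Integrable (fun g => c * (S : Set (Gqs L v)).indicator (fun _ => (1 : ℂ)) g) νQv := fun S hSo hSc c =>
    (((isLocSmooth_indicator_subgroup S hSo hSc).continuous.integrable_of_hasCompactSupport
      (isLocSmooth_indicator_subgroup S hSo hSc).hasCompactSupport)).const_mul c
  have hintv : ∀ S : Subgroup (Gqs L v), IsOpen (S : Set (Gqs L v)) → ∀ c : ℂ,
      ∫ g, c * (S : Set (Gqs L v)).indicator (fun _ => (1 : ℂ)) g ∂νQv = c * ((νQv S).toReal : ℂ) := by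
    intro S hSo c
    rw [integral_const_mul, integral_indicator_const (1 : ℂ) hSo.measurableSet, Complex.real_smul, mul_one]
    rfl
  -- Kottwitz's function
  set fG : Gqs L v → ℂ := fun g => (((νQv K0).toReal : ℂ))⁻¹ * (K0 : Set (Gqs L v)).indicator (fun _ => (1 : ℂ)) g +
      (((νQv K1).toReal : ℂ))⁻¹ * (K1 : Set (Gqs L v)).indicator (fun _ => (1 : ℂ)) g -
      (((νQv I).toReal : ℂ))⁻¹ * (I : Set (Gqs L v)).indicator (fun _ => (1 : ℂ)) g with hfGdef
  have hsmooth : IsLocSmooth fG := isLocSmooth_epCombination K0 K1 I hK0o hK0c hK1o hK1c hIo hIc _ _ _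
  have iK0 := hint K0 hK0o hK0c ((((νQv K0).toReal : ℂ))⁻¹)
  have iK1 := hint K1 hK1o hK1c ((((νQv K1).toReal : ℂ))⁻¹)
  have iI := hint I hIo hIc ((((νQv I).toReal : ℂ))⁻¹)
  have hfG1 : fG 1 = (((νQv K0).toReal : ℂ))⁻¹ + (((νQv K1).toReal : ℂ))⁻¹ - (((νQv I).toReal : ℂ))⁻¹ := by
    simp only [hfGdef, Set.indicator_of_mem (SetLike.mem_coe.2 K0.one_mem), Set.indicator_of_mem (SetLike.mem_coe.2 K1.one_mem),
      Set.indicator_of_mem (SetLike.mem_coe.2 I.one_mem), mul_one]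
  have hfG1re : (fG 1).re = ((νQv K0).toReal)⁻¹ + ((νQv K1).toReal)⁻¹ - ((νQv I).toReal)⁻¹ := by
    rw [hfG1, ← Complex.ofReal_inv, ← Complex.ofReal_inv, ← Complex.ofReal_inv, ← Complex.ofReal_add, ← Complex.ofReal_sub, Complex.ofReal_re]
  refine ⟨hsmooth, hsmooth.continuous.measurable, (iK0.add iK1).sub iI, ?_, ?_, ?_, ?_, ?_⟩
  · -- mass one
    have h1 : ∫ g, fG g ∂νQv = (∫ g, (((νQv K0).toReal : ℂ))⁻¹ * (K0 : Set (Gqs L v)).indicator (fun _ => (1 : ℂ)) g ∂νQv +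
        ∫ g, (((νQv K1).toReal : ℂ))⁻¹ * (K1 : Set (Gqs L v)).indicator (fun _ => (1 : ℂ)) g ∂νQv) -
        ∫ g, (((νQv I).toReal : ℂ))⁻¹ * (I : Set (Gqs L v)).indicator (fun _ => (1 : ℂ)) g ∂νQv := by
      have h := integral_sub (μ := νQv)
        (f := fun g => (((νQv K0).toReal : ℂ))⁻¹ * (K0 : Set (Gqs L v)).indicator (fun _ => (1 : ℂ)) g +
          (((νQv K1).toReal : ℂ))⁻¹ * (K1 : Set (Gqs L v)).indicator (fun _ => (1 : ℂ)) g)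
        (g := fun g => (((νQv I).toReal : ℂ))⁻¹ * (I : Set (Gqs L v)).indicator (fun _ => (1 : ℂ)) g) (iK0.add iK1) iI
      rw [integral_add iK0 iK1] at h
      exact h
    rw [h1, hintv K0 hK0o, hintv K1 hK1o, hintv I hIo, inv_mul_cancel₀ (hvol K0 hK0o hK0c), inv_mul_cancel₀ (hvol K1 hK1o hK1c),
      inv_mul_cancel₀ (hvol I hIo hIc)]
    norm_num
  · -- `fG 1` is real
    rw [hfG1, ← Complex.ofReal_inv, ← Complex.ofReal_inv, ← Complex.ofReal_inv, ← Complex.ofReal_add, ← Complex.ofReal_sub, Complex.ofReal_im]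
  · -- `fG 1 < 0` (from the wild-tree indices `q + 1`, `q + 1` of ★ `index_inf_subgroupOf_eq_of_isRamifiedQuadraticDatum` (U0 `stub_U0_iwahoriIndex_wild`), transported along `eA`; ★ §1 sign lemma)
    have hidx := UnitaryLatticeTree.index_inf_subgroupOf_eq_of_isRamifiedQuadraticDatum (galAdicCompletionMap (L := L) (IsCMField.complexConj L) hw) ϖ d t hD g₁ hg₁
    have h0 : (I.subgroupOf K0).index = Nat.card 𝓀[w.1.adicCompletion L] + 1 := by
      rw [hIdef, hK0def, index_subgroupOf_comap_mulEquiv]; exact hidx.1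
    have h1 : (I.subgroupOf K1).index = Nat.card 𝓀[w.1.adicCompletion L] + 1 := by
      rw [hIdef, hK1def, index_subgroupOf_comap_mulEquiv]; exact hidx.2
    haveI : (I.subgroupOf K0).FiniteIndex := ⟨by rw [h0]; exact Nat.succ_ne_zero _⟩
    haveI : (I.subgroupOf K1).FiniteIndex := ⟨by rw [h1]; exact Nat.succ_ne_zero _⟩
    have hq2 : 2 ≤ Nat.card 𝓀[w.1.adicCompletion L] := Finite.one_lt_card
    have hmpos : 0 < (νQv I).toReal :=
      ENNReal.toReal_pos (hIo.measure_pos νQv ⟨1, I.one_mem⟩).ne' hIc.measure_lt_top.ne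
    have ha : (νQv K0).toReal = ((Nat.card 𝓀[w.1.adicCompletion L] : ℝ) + 1) * (νQv I).toReal := by
      have h := UnitaryLatticeTree.measureReal_coe_eq_index_mul νQv (Subgroup.comap_mono inf_le_left : I ≤ K0) hIo
      rw [h0, measureReal_def, measureReal_def] at h
      rw [h]; push_cast; ring
    have hb : (νQv K1).toReal = ((Nat.card 𝓀[w.1.adicCompletion L] : ℝ) + 1) * (νQv I).toReal := by
      have h := UnitaryLatticeTree.measureReal_coe_eq_index_mul νQv (Subgroup.comap_mono inf_le_right : I ≤ K1) hIo
      rw [h1, measureReal_def, measureReal_def] at h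
      rw [h]; push_cast; ring
    rw [hfG1re]
    exact epValueAtOne_neg_of_ramified hmpos hq2 ha hb
  · -- elliptic regular classes: (E) = ★ EULER-G-WILD on `U(σ_w, J₀)(L_w)`, finiteness from the compact centraliser and the closed regular class, counts transported along `eA`
    intro γ hreg hZc
    haveI : CompactSpace (Subgroup.centralizer ({γ} : Set (Gqs L v))) := isCompact_iff_compactSpace.1 hZc
    have hO := UnitaryGroup.isClosed_conjClass_local_of_isRegularElt L 3 (qsForm L) v hHf hdetf γ hreg
    -- finiteness of the fixed sets, proved on `G_v` and moved to `U(σ_w, J₀)(L_w)`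
    have hfin : ∀ C : Subgroup ↥(unitaryGroupOfForm (galAdicCompletionMap (L := L) (IsCMField.complexConj L) hw) ((StdForm.antidiagonal 3).over (w.1.adicCompletion L))), IsOpen ((C.comap eA.toMulEquiv.toMonoidHom : Subgroup (Gqs L v)) : Set (Gqs L v)) →
        IsCompact ((C.comap eA.toMulEquiv.toMonoidHom : Subgroup (Gqs L v)) : Set (Gqs L v)) → (MulAction.fixedBy (↥(unitaryGroupOfForm (galAdicCompletionMap (L := L) (IsCMField.complexConj L) hw) ((StdForm.antidiagonal 3).over (w.1.adicCompletion L))) ⧸ C) (eA γ)).Finite := by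
      intro C hCo hCc
      haveI := (finite_fixedBy_quotient_of_isClosed γ (C.comap eA.toMulEquiv.toMonoidHom) hO hCo hCc).to_subtype
      obtain ⟨Φ, -⟩ := exists_equiv_fixedBy_quotient_congr (C.comap eA.toMulEquiv.toMonoidHom) C eA.toMulEquiv (fun g => Iff.rfl) γ
      exact Set.finite_coe_iff.1 (Finite.of_equiv _ Φ)
    -- the centraliser of `eA γ` in `U(σ_w, J₀)(L_w)` is the (compact) image of `Z(γ)`
    have hZeq : ((Subgroup.centralizer ({eA γ} : Set ↥(unitaryGroupOfForm (galAdicCompletionMap (L := L) (IsCMField.complexConj L) hw) ((StdForm.antidiagonal 3).over (w.1.adicCompletion L))))) : Set ↥(unitaryGroupOfForm (galAdicCompletionMap (L := L) (IsCMField.complexConj L) hw) ((StdForm.antidiagonal 3).over (w.1.adicCompletion L)))) = eA '' ((Subgroup.centralizer ({γ} : Set (Gqs L v))) : Set (Gqs L v)) := by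
      ext u
      simp only [SetLike.mem_coe, Subgroup.mem_centralizer_singleton_iff, Set.mem_image]
      constructor
      · intro hu
        refine ⟨eA.symm u, ?_, eA.apply_symm_apply u⟩
        apply eA.injective
        rw [map_mul, map_mul, eA.apply_symm_apply]
        exact hu
      · rintro ⟨g, hg, rfl⟩
        rw [← map_mul, ← map_mul, hg]
    have hZc' : IsCompact ((Subgroup.centralizer ({eA γ} : Set ↥(unitaryGroupOfForm (galAdicCompletionMap (L := L) (IsCMField.complexConj L) hw) ((StdForm.antidiagonal 3).over (w.1.adicCompletion L))))) : Set ↥(unitaryGroupOfForm (galAdicCompletionMap (L := L) (IsCMField.complexConj L) hw) ((StdForm.antidiagonal 3).over (w.1.adicCompletion L)))) := by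
      rw [hZeq]; exact hZc.image eA.continuous
    haveI : CompactSpace (Subgroup.centralizer ({eA γ} : Set ↥(unitaryGroupOfForm (galAdicCompletionMap (L := L) (IsCMField.complexConj L) hw) ((StdForm.antidiagonal 3).over (w.1.adicCompletion L))))) := isCompact_iff_compactSpace.1 hZc'
    have hK0wo : IsOpen (K0w : Set ↥(unitaryGroupOfForm (galAdicCompletionMap (L := L) (IsCMField.complexConj L) hw) ((StdForm.antidiagonal 3).over (w.1.adicCompletion L)))) := by
      rw [hK0wdef]; exact UnitaryLatticeTree.isOpen_glInt_subgroupOf (galAdicCompletionMap (L := L) (IsCMField.complexConj L) hw) ((StdForm.antidiagonal 3).over (w.1.adicCompletion L))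
    have horb := finite_range_pow_quotient_of_isOpen (G := ↥(unitaryGroupOfForm (galAdicCompletionMap (L := L) (IsCMField.complexConj L) hw) ((StdForm.antidiagonal 3).over (w.1.adicCompletion L)))) (eA γ) K0w hK0wo
    have hE := UnitaryLatticeTree.fixedSet_subtree_of_isRamifiedQuadraticDatum (galAdicCompletionMap (L := L) (IsCMField.complexConj L) hw) ϖ d t hD g₁ hg₁ (eA γ) (hfin K0w hK0o hK0c) (hfin K1w hK1o hK1c) horb
    rw [hfGdef, classOrbitalIntegral_epCombination_eq_of_compactSpace L 3 (qsForm L) v νQv hHf hdetf hcanQ K0 K1 I hK0o hK0c hK1o hK1c hIo hIc γ hreg,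
      natCard_fixedBy_quotient_congr K0 K0w eA.toMulEquiv (fun g => Iff.rfl) γ, natCard_fixedBy_quotient_congr K1 K1w eA.toMulEquiv (fun g => Iff.rfl) γ,
      natCard_fixedBy_quotient_congr I (K0w ⊓ K1w) eA.toMulEquiv (fun g => Iff.rfl) γ]
    have hE' : (Nat.card (MulAction.fixedBy (↥(unitaryGroupOfForm (galAdicCompletionMap (L := L) (IsCMField.complexConj L) hw) ((StdForm.antidiagonal 3).over (w.1.adicCompletion L))) ⧸ K0w) (eA.toMulEquiv γ)) : ℂ) + (Nat.card (MulAction.fixedBy (↥(unitaryGroupOfForm (galAdicCompletionMap (L := L) (IsCMField.complexConj L) hw) ((StdForm.antidiagonal 3).over (w.1.adicCompletion L))) ⧸ K1w) (eA.toMulEquiv γ)) : ℂ) =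
        (Nat.card (MulAction.fixedBy (↥(unitaryGroupOfForm (galAdicCompletionMap (L := L) (IsCMField.complexConj L) hw) ((StdForm.antidiagonal 3).over (w.1.adicCompletion L))) ⧸ (K0w ⊓ K1w)) (eA.toMulEquiv γ)) : ℂ) + 1 := by exact_mod_cast hE
    rw [hE', add_sub_cancel_left]
  · -- non-elliptic regular classes: (N) = ★ THEOREM C₃ for any involution, (A)(B)(I) discharged on the wild tree, kit (T1) := ★ §0 of (G3)-RAM and (T2) := ★ (T2)-RAM
    intro γ hreg hZnc
    -- the three levels by membership through `eU`
    have hmem : ∀ (C : Subgroup (GL (Fin 3) (w.1.adicCompletion L))) (g : Gqs L v),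
        g ∈ ((C.subgroupOf (unitaryGroupOfForm (galAdicCompletionMap (L := L) (IsCMField.complexConj L) hw) ((StdForm.antidiagonal 3).over (w.1.adicCompletion L)))).comap eA.toMulEquiv.toMonoidHom : Subgroup (Gqs L v)) ↔
          ((eU g : ↥(unitaryGroupOfForm (galAdicCompletionMap (L := L) (IsCMField.complexConj L) hw) (placeForm (qsForm L) w.1))) : GL (Fin 3) (w.1.adicCompletion L)) ∈ C := by
      intro C g
      rw [Subgroup.mem_comap, Subgroup.mem_subgroupOf, ← heA g]
      rfl
    have hImem : ∀ g : Gqs L v, g ∈ I ↔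
        ((eU g : ↥(unitaryGroupOfForm (galAdicCompletionMap (L := L) (IsCMField.complexConj L) hw) (placeForm (qsForm L) w.1))) : GL (Fin 3) (w.1.adicCompletion L)) ∈ glInt 3 (w.1.adicCompletion L) ∧
          ((eU g : ↥(unitaryGroupOfForm (galAdicCompletionMap (L := L) (IsCMField.complexConj L) hw) (placeForm (qsForm L) w.1))) : GL (Fin 3) (w.1.adicCompletion L)) ∈
            (glInt 3 (w.1.adicCompletion L)).map (MulAut.conj g₁).toMonoidHom := by
      intro g
      rw [hIdef, Subgroup.mem_comap, Subgroup.mem_inf, hK0wdef, hK1wdef, Subgroup.mem_subgroupOf, Subgroup.mem_subgroupOf, ← heA g]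
      rfl
    -- the antidiagonal shape of `(Φ₃)_w`
    have hform := TypeThreeTorus.placeForm_qsForm_eq L w
    have hJ : ∀ i j : Fin 3, j ≠ Fin.rev i → placeForm (qsForm L) w.1 i j = 0 := by
      intro i j hij
      rw [hform]
      fin_cases i <;> fin_cases j <;> first | rfl | exact absurd (by decide) hij
    have hH₀₂ : placeForm (qsForm L) w.1 0 2 ≠ 0 := by rw [hform]; exact one_ne_zero
    have hH₁₁ : placeForm (qsForm L) w.1 1 1 ≠ 0 := by rw [hform]; exact one_ne_zero
    -- `IsRegularElt` is a class function on `G_v`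
    have hP : ∀ g x : Gqs L v, IsRegularElt (g.val : GL (Fin 3) (UnitaryGroup.LocalRing L v)) →
        IsRegularElt ((x * g * x⁻¹).val : GL (Fin 3) (UnitaryGroup.LocalRing L v)) := fun g x hg => isRegularElt_val_conj L 3 _ v g x hg
    -- (T1) := ★ §0 of (G3)-RAM at the uniformiser `ϖ` (any): a regular DIAGONAL representative `δ` of the class of `γ`, valuation profile `(|ϖ^c|, 1, |ϖ^{−c}|)`
    obtain ⟨γ', e, c, hconj, hδm', -, he₀, he₁, he₂⟩ :=
      exists_conj_coe_localNonsplitEquiv_eq_diagonal_of_not_isCompact_centralizer_of_v L v hns w hw hϖv hreg hZnc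
    obtain ⟨g, hg⟩ := isConj_iff.1 hconj
    have hcl : ConjClasses.mk (g * γ * g⁻¹) = ConjClasses.mk γ := ConjClasses.mk_eq_mk_iff_isConj.2 (isConj_iff.2 ⟨g, rfl⟩).symm
    have hδm : (((eU (g * γ * g⁻¹) : ↥(unitaryGroupOfForm (galAdicCompletionMap (L := L) (IsCMField.complexConj L) hw) (placeForm (qsForm L) w.1))) : GL (Fin 3) (w.1.adicCompletion L)) :
        Matrix (Fin 3) (Fin 3) (w.1.adicCompletion L)) = Matrix.diagonal e := by rw [hg]; exact hδm'
    have hregδ : IsRegularElt ((g * γ * g⁻¹).val : GL (Fin 3) (UnitaryGroup.LocalRing L v)) := isRegularElt_val_conj L 3 _ v γ g hreg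
    -- (T2) := ★ (T2)-RAM `exists_splitTorus_generator_local_of_nonsplit_three_of_involution` (any involution; regularity of the diagonal from the separable characteristic polynomial)
    haveI := isDiscreteValuationRing_integer_of_compatible hϖv
    have hsep : (Matrix.diagonal e).charpoly.Separable := by
      rw [← hδm]; exact (TypeThreeTorus.isRegularElt_iff_separable_localNonsplitEquiv L w hw _).1 hregδ
    have hinj : Function.Injective e := by
      rw [Matrix.charpoly_diagonal] at hsep; exact Polynomial.separable_prod_X_sub_C_iff.1 hsep
    obtain ⟨τ, hτm, hgen, hfree⟩ := exists_splitTorus_generator_local_of_nonsplit_three_of_involution (IsCMField.complexConj L) (qsForm L) hc1 w hw hJ hH₀₂ hH₁₁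
      (isUniformizingElement_of_v_eq hϖv) hδm (fun i j hij => isUnit_iff_ne_zero.2 (sub_ne_zero.2 fun h => hij (hinj h)))
    -- the compact-core facts and the closed class of `δ`
    obtain ⟨hcomm, hcc, hco⟩ := compactCore_centralizer_local_facts_of_isRegularElt (IsCMField.complexConj L) 3 _ hc1
      (UnitaryGroup.antidiagOne_map_transpose (IsCMField.complexConj L) 3) (isUnit_antidiagOne_det L 3) (g * γ * g⁻¹) hregδ
    have hO := UnitaryGroup.isClosed_conjClass_local_of_isRegularElt L 3 (qsForm L) v hHf hdetf (g * γ * g⁻¹) hregδ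
    -- (A)(B)(I): the three transitivities of `U(σ_w, Φ₃)` on the WILD lattice tree at the datum (★ htr₀-WILD, ★ htr₂-WILD, ★ wild flags)
    have hA : ∀ M : Submodule 𝒪[w.1.adicCompletion L] (Fin 3 → w.1.adicCompletion L),
        UnitaryLatticeTree.IsSelfDualLattice (galAdicCompletionMap (L := L) (IsCMField.complexConj L) hw) ϖ ((StdForm.antidiagonal 3).over (w.1.adicCompletion L)) M →
        ∃ u : ↥(unitaryGroupOfForm (galAdicCompletionMap (L := L) (IsCMField.complexConj L) hw) ((StdForm.antidiagonal 3).over (w.1.adicCompletion L))), UnitaryLatticeTree.mapGL (u : GL (Fin 3) (w.1.adicCompletion L)) (HermitianLattice.stdLattice (w.1.adicCompletion L) 3) = M := fun M hM => by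
      obtain ⟨u, hu⟩ := UnitaryLatticeTree.exists_unitary_mapGL_stdLattice_eq_of_isSelfDualLattice_of_ramified
        hD.1 hD.2.1 hD.2.2.1 hD.2.2.2.1 hD.2.2.2.2.1 hD.2.2.2.2.2.1 hD.2.2.2.2.2.2 M hM
      exact ⟨u, hu.symm⟩
    have hN₁ : UnitaryLatticeTree.mapGL g₁ (HermitianLattice.stdLattice (w.1.adicCompletion L) 3) =
        UnitaryLatticeTree.latt (Matrix.diagonal ![(1 : w.1.adicCompletion L), 1, ϖ]) := by rw [← hg₁]; rfl
    have hB : ∀ M : Submodule 𝒪[w.1.adicCompletion L] (Fin 3 → w.1.adicCompletion L),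
        UnitaryLatticeTree.IsVertexLattice (galAdicCompletionMap (L := L) (IsCMField.complexConj L) hw) ϖ ((StdForm.antidiagonal 3).over (w.1.adicCompletion L)) 2 M →
        ∃ u : ↥(unitaryGroupOfForm (galAdicCompletionMap (L := L) (IsCMField.complexConj L) hw) ((StdForm.antidiagonal 3).over (w.1.adicCompletion L))), UnitaryLatticeTree.mapGL ((u : GL (Fin 3) (w.1.adicCompletion L)) * g₁) (HermitianLattice.stdLattice (w.1.adicCompletion L) 3) = M :=
      fun M hM => by
      obtain ⟨u, hu⟩ := htr₂_of_isRamifiedQuadraticDatum hD M hM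
      exact ⟨u, by rw [UnitaryLatticeTree.mapGL_mul, hN₁]; exact hu.symm⟩
    have hflag := UnitaryLatticeTree.flagTransitive_of_isRamifiedQuadraticDatum (galAdicCompletionMap (L := L) (IsCMField.complexConj L) hw) ϖ d t hD g₁ hg₁
    -- `Φ(ν(C)⁻¹ · 𝟙_C) = ν(C)⁻¹ · Φ(𝟙_C)` ×3 (★ linearity at a regular class), pass to `δ`, then ★ THEOREM C₃ on the model `e_w`
    rw [hfGdef, classOrbitalIntegral_epCombination_eq L 3 (qsForm L) v hHf hdetf hcanQ.isAdmissibleOn K0 K1 I hK0o hK0c hK1o hK1c hIo hIc _ _ _ γ hreg, ← hcl]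
    exact epCombination_classOrbitalIntegral_eq_zero_of_latticeModel_three_of_transitive hP hcanQ hσσ hvσ hϖv g₁ hg₁ hA hB hflag hJw eU.toMulEquiv K0 K1 I
      (hmem _) (hmem _) hImem hK0o hK0c hK1o hK1c hIo hIc hregδ hO hcomm hcc hco τ hgen hfree hτm hδm he₀ he₁ he₂

end Summit.HodgeConjecture.HodgeConjecture.Cruxes.H413.K2E3EPFunctionGRamifiedExplicit

end
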